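import Mathlib
import Summits.Ventures.HodgeRepro.LitRankLeopoldt
import Summits.Ventures.HodgeRepro.LitLFunctionZero

/-!
# LitRankTheta — Kubota's `Θ = Σ_{a=1}^{p−1} ψ(a)·a` does not vanish for odd `ψ`

Blind cell `pub-hodge-repro`, seat lit-2 (gen 6).  Closes the single analytic input left open by
`LitRankLeopoldt.lean` (same seat, gen 5): for an odd prime `p` and a character `ψ` of `(ℤ/p)ˣ`
with `ψ(−1) = −1`, `Θ = Σ_{a=1}^{p−1} ψ(a)·a ≠ 0`.  Kubota 1965 (store
`paper:doi-10-1090-s0002-9947-1965-0190144-8`, p0008:L41–L46) says "we have always Θ ≠ 0, because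
Θ is a factor contained in the class number formula of the cyclotomic field" — i.e. `Θ/p = B_{1,ψ}`
is the generalised Bernoulli number, `L(0, ψ) = −B_{1,ψ}`, and `L(0, ψ) ≠ 0` because the
functional equation turns it into a non-zero multiple of `L(1, ψ̄) ≠ 0`.

This file carries out exactly that argument on Mathlib:

* `theta_eq_sum`: `Θ = Σ_{x ∈ ℤ/p} χ(x)·x` for the Dirichlet character `χ = MulChar.ofUnitHom ψ`;
* `theta_ne_zero`: `Θ = −p·L(χ, 0) ≠ 0`, by `LitLFunctionZero.lean`'s
  `LFunction_zero_eq_neg_sum_div` (the value `L(χ, 0) = −(1/p)Σ χ(x)·x`, from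
  `LitHurwitzZero.lean`'s `ζ(0, a) = 1/2 − a`) and `LFunction_zero_ne_zero_of_odd` (functional
  equation, Gauss sum, `L(χ̄, 1) ≠ 0`);
* `Kubota1965_lemma3_Leopoldt_holds`: Kubota 1965, Lemma 3 (Leopoldt), discharged unconditionally
  through `LitRankLeopoldt.lean`'s `Kubota1965_lemma3_of_theta`.
-/

namespace HodgeRepro.Lit2

open Finset

namespace Leopoldt

variable (p : ℕ) [hp : Fact p.Prime] (ψ : (ZMod p)ˣ →* ℂˣ)

/-- The Dirichlet character mod `p` attached to `ψ` (extension by `0`). -/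
noncomputable def chi : DirichletCharacter ℂ p := MulChar.ofUnitHom ψ

/-- `χ` agrees with `ψ̃ = ext p ψ` on all of `ℤ/p`. -/
theorem chi_apply (x : ZMod p) : chi p ψ x = ext p ψ x := by
  unfold chi ext
  split_ifs with hx
  · subst hx; exact MulChar.map_zero _
  · conv_lhs => rw [← Units.val_mk0 hx]
    exact MulChar.ofUnitHom_coe ψ (Units.mk0 x hx)

/-- `ψ(−1) = −1` makes `χ` an odd Dirichlet character. -/
theorem chi_odd (hψ : ψ (-1) = -1) : (chi p ψ).Odd := by
  unfold DirichletCharacter.Odd chi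
  rw [show (-1 : ZMod p) = ((-1 : (ZMod p)ˣ) : ZMod p) by simp, MulChar.ofUnitHom_coe, hψ]
  simp

/-- **`Θ = Σ_{x ∈ ℤ/p} χ(x)·x`** (reindexing Kubota's sum over `1 ≤ a ≤ p − 1` by residues; the
residue `0` contributes `χ(0)·0 = 0`). -/
theorem theta_eq_sum : theta p ψ = ∑ x : ZMod p, chi p ψ x * (x.val : ℂ) := by
  unfold theta
  have hp1 : range p = range ((p - 1) + 1) := by
    rw [Nat.sub_add_cancel hp.out.one_lt.le]
  have h1 : ∑ j ∈ range (p - 1), ext p ψ ((j + 1 : ℕ) : ZMod p) * ((j + 1 : ℕ) : ℂ)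
      = ∑ k ∈ range p, ext p ψ (k : ZMod p) * (k : ℂ) := by
    rw [hp1, Finset.sum_range_succ']
    simp [ext_zero]
  rw [h1]
  symm
  refine Finset.sum_nbij' (fun x : ZMod p => x.val) (fun k : ℕ => (k : ZMod p)) ?_ ?_ ?_ ?_ ?_
  · intro x _; exact Finset.mem_range.2 (ZMod.val_lt x)
  · intro k _; exact Finset.mem_univ _
  · intro x _; exact ZMod.natCast_zmod_val x
  · intro k hk; exact ZMod.val_natCast_of_lt (Finset.mem_range.1 hk)
  · intro x _; rw [chi_apply, ZMod.natCast_zmod_val]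

end Leopoldt

/-- **Kubota's `Θ ≠ 0`** (p0008:L41–L46, "Θ is a factor contained in the class number formula"):
for every prime `p` and every `ψ : (ℤ/p)ˣ → ℂˣ` with `ψ(−1) = −1`, `Θ = Σ_{a=1}^{p−1} ψ(a)·a ≠ 0`.
Proof: `Θ = −p·L(χ, 0)` and `L(χ, 0) ≠ 0` for the odd character `χ = ψ̃`. -/
theorem theta_ne_zero (p : ℕ) [hp : Fact p.Prime] (ψ : (ZMod p)ˣ →* ℂˣ) (hψ : ψ (-1) = -1) :
    Leopoldt.theta p ψ ≠ 0 := by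
  rw [Leopoldt.theta_eq_sum]
  have hodd := Leopoldt.chi_odd p ψ hψ
  have hL := HurwitzZero.LFunction_zero_ne_zero_of_odd (Leopoldt.chi p ψ) hodd
  rw [HurwitzZero.LFunction_zero_eq_neg_sum_div hp.out.one_lt.ne' _ (HurwitzZero.Odd.ne_one' hodd)]
    at hL
  intro h
  apply hL
  rw [h]
  simp

/-- **Kubota 1965, Lemma 3 (Leopoldt), holds**: for `p = 2m + 1` an odd prime and `ψ` a character
of `(ℤ/p)ˣ` with `ψ(−1) = −1`, `Σ_{a=1}^{m} ψ(a) ≠ 0` (the named fact of `LitRank.lean`). -/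
theorem Kubota1965_lemma3_Leopoldt_holds : Kubota1965_lemma3_Leopoldt :=
  Kubota1965_lemma3_of_theta (by
    intro p _ _ ψ hψ
    exact theta_ne_zero p ψ hψ)

end HodgeRepro.Lit2
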